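import Mathlib.RingTheory.Valuation.ValuationRing
import Mathlib.RingTheory.Length
import Mathlib.LinearAlgebra.Span.Basic
import HarnessLib

/-!
# Cyclic modules over a valuation ring are uniserial: submodules are totally ordered, lengths compare by `min`

Topic `RingTheory/DiscreteValuationRing`; namespace `Literature.RingTheory.DiscreteValuationRing`. THEOREMS ONLY
(Mathlib-only imports; no definition, no named fact, no instance, no `sorry`).

For a valuation ring `R` (in particular a discrete valuation ring) and a CYCLIC `R`-module `M = R · m`:
* `le_or_le_of_span_singleton_eq_top` — any two submodules `P, Q ≤ M` are comparable (`P ≤ Q ∨ Q ≤ P`): pull back along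
  `R ↠ M`, `r ↦ r m`, to ideals of `R`, which are totally ordered (Mathlib `ValuationRing.le_total_ideal`), and push
  forward;
* `inf_eq_or_inf_eq`, **`length_inf_eq_min`** — hence `P ⊓ Q ∈ {P, Q}` and
  `length (P ⊓ Q) = min (length P, length Q)`.

This is the «uniseriality of `B'/π^N`» step in the Kähler-differential proof of Tate's almost étale lemma (the kernel
of `Ω_{B/A} ⊗ B' → Ω_{B'/A} → Ω_{B'/A'}` is the smaller of the two cyclic submodules `im(Ω_{B/A} ⊗ B')`,
`Ω_{A'/A} ⊗ B'` of the cyclic `B'`-module `Ω_{B'/A}`), crux dir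
`Summits/BirchSwinnertonDyer/…/StarredOptimalManinUnitFiveSeven/Lines/kato-lever-TS1-omega-route.md`, step «kernel».
Standard commutative algebra: ideals of a valuation ring are totally ordered (H. Matsumura, *Commutative Ring Theory*,
Thm. 10.1), and submodules of `R/I` correspond to ideals containing `I`.

## References
* H. Matsumura, *Commutative Ring Theory* (CUP, 1986/1989), Thm. 10.1 (ideals of a valuation ring are totally
  ordered), §2 (submodules of cyclic modules). [Matsumura1987]
* J.-P. Serre, *Local Fields* (1979), Ch. I §2 (modules over discrete valuation rings). [SerreLocalFields1979]
-/

namespace Literature.RingTheory.DiscreteValuationRing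

variable {R M : Type*} [CommRing R] [IsDomain R] [ValuationRing R] [AddCommGroup M] [Module R M]

/-- **Submodules of a cyclic module over a valuation ring are totally ordered.** If `M = R · m` then for all
submodules `P, Q ≤ M`: `P ≤ Q ∨ Q ≤ P` (ideals of `R` are totally ordered; submodules of `R · m ≅ R/Ann(m)` are images of
ideals). [cite: Matsumura1987, Thm. 10.1 (ideals of a valuation ring are totally ordered)] -/
theorem le_or_le_of_span_singleton_eq_top {m : M} (hm : Submodule.span R {m} = ⊤) (P Q : Submodule R M) :
    P ≤ Q ∨ Q ≤ P := by
  let φ : R →ₗ[R] M := LinearMap.toSpanSingleton R M m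
  have hφ : Function.Surjective φ := by
    intro x
    have hx : x ∈ Submodule.span R {m} := by rw [hm]; exact Submodule.mem_top
    obtain ⟨r, hr⟩ := Submodule.mem_span_singleton.1 hx
    exact ⟨r, hr⟩
  have hP : P = (P.comap φ).map φ := (Submodule.map_comap_eq_of_surjective hφ P).symm
  have hQ : Q = (Q.comap φ).map φ := (Submodule.map_comap_eq_of_surjective hφ Q).symm
  rcases total_of (· ≤ ·) (P.comap φ : Ideal R) (Q.comap φ) with h | h
  · left; rw [hP, hQ]; exact Submodule.map_mono h
  · right; rw [hP, hQ]; exact Submodule.map_mono h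

/-- In a cyclic module over a valuation ring, `P ⊓ Q` is `P` or `Q`. [cite: Matsumura1987, Thm. 10.1] -/
theorem inf_eq_or_inf_eq {m : M} (hm : Submodule.span R {m} = ⊤) (P Q : Submodule R M) :
    P ⊓ Q = P ∨ P ⊓ Q = Q := by
  rcases le_or_le_of_span_singleton_eq_top hm P Q with h | h
  · exact Or.inl (inf_eq_left.2 h)
  · exact Or.inr (inf_eq_right.2 h)

/-- **Lengths in a cyclic module over a valuation ring compare by `min`**: `length (P ⊓ Q) = min (length P) (length Q)`
for submodules `P, Q` of `M = R · m`. [cite: Matsumura1987, Thm. 10.1 (with §2)] -/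
theorem length_inf_eq_min {m : M} (hm : Submodule.span R {m} = ⊤) (P Q : Submodule R M) :
    Module.length R ↥(P ⊓ Q) = min (Module.length R P) (Module.length R Q) := by
  rcases le_or_le_of_span_singleton_eq_top hm P Q with h | h
  · rw [inf_eq_left.2 h, min_eq_left]
    exact Module.length_le_of_injective (Submodule.inclusion h) (Submodule.inclusion_injective h)
  · rw [inf_eq_right.2 h, min_eq_right]
    exact Module.length_le_of_injective (Submodule.inclusion h) (Submodule.inclusion_injective h)

omit [IsDomain R] [ValuationRing R] in
/-- Nested submodules of equal finite length coincide (any commutative ring): if `P ≤ Q` and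
`length P = length Q < ∞` then `P = Q` (additivity of length on `0 → P → Q → Q/P → 0`). With the uniseriality above,
a submodule of a cyclic module of finite length over a valuation ring is determined by its length.
[cite: Matsumura1987, §2 and Thm. 10.1] -/
theorem eq_of_le_of_length_eq {P Q : Submodule R M} (hPQ : P ≤ Q)
    (hfin : Module.length R Q ≠ ⊤) (hlen : Module.length R P = Module.length R Q) : P = Q := by
  -- `0 → P → Q → Q/P → 0`: `length Q = length P + length (Q/P)`, so `Q/P = 0`
  have hex := Module.length_eq_add_of_exact (Submodule.inclusion hPQ) (Submodule.mkQ (P.comap Q.subtype))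
    (Submodule.inclusion_injective hPQ) (Submodule.mkQ_surjective _) (by
      refine LinearMap.exact_iff.2 ?_
      rw [Submodule.ker_mkQ]
      ext x
      simp only [Submodule.mem_comap, Submodule.subtype_apply, LinearMap.mem_range]
      constructor
      · intro hx; exact ⟨⟨x, hx⟩, rfl⟩
      · rintro ⟨y, rfl⟩; exact y.2)
  rw [hlen] at hex
  have h0 : Module.length R (↥Q ⧸ Submodule.comap Q.subtype P) = 0 := by
    obtain ⟨n, hn⟩ := ENat.ne_top_iff_exists.1 hfin
    rw [← hn] at hex
    have hk : Module.length R (↥Q ⧸ Submodule.comap Q.subtype P) ≠ ⊤ := by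
      intro hk
      rw [hk, add_top] at hex
      exact ENat.coe_ne_top n hex
    obtain ⟨j, hj⟩ := ENat.ne_top_iff_exists.1 hk
    rw [← hj] at hex ⊢
    norm_cast at hex
    have hj0 : j = 0 := by omega
    rw [hj0]
    rfl
  rw [Module.length_eq_zero_iff] at h0
  refine le_antisymm hPQ fun x hx => ?_
  have h1 : (Submodule.Quotient.mk ⟨x, hx⟩ : ↥Q ⧸ Submodule.comap Q.subtype P) = 0 := Subsingleton.elim _ _
  rw [Submodule.Quotient.mk_eq_zero, Submodule.mem_comap] at h1
  exact h1

end Literature.RingTheory.DiscreteValuationRing
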